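import Summits.PneNP.PneNP.Theorems.PhaseTwinsMacroscopicTwinsAboveHighActivityDefs
import Summits.PneNP.PneNP.Theorems.PhaseTwinsMacroscopicTwinsAboveDuplicator
import Summits.PneNP.PneNP.Theorems.PhaseTwinsPolyDepthTwinsAboveMaxDegree
import Literature.ModelTheory.FiniteModelTheory.XorLocalConsistency

/-!
# Route PhaseTwins, item `MacroscopicTwinsAbove` (stmt-PneNP-2720), high-activity regime:
# Duplicator and the degree bound for the conflict-gadget twins

For the degree-3 conflict-gadget graphs `cgGraph E loc c` of `PhaseTwinsMacroscopicTwinsAboveHighActivityDefs`: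

* `cg_ckEquiv` — on an `(s, q/p)`-boundary expander with three distinct variables per equation, `2pK₀ ≤ qs` and
  `3k ≤ K₀`, the graphs of ANY right-hand side `c` and of `0` are `≡_{C^k}`: ONE instance of the abstract transfer
  theorem `ckEquiv_of_consistencyFamily` (Atserias–Dawar 2019, Lemma 3.2) with the gauge action `cgFlip`
  (all piece indices are gauge-invariant, so only the two free bits move), the consistency family
  `XorSystem.Good (lgScope E) c s` and the compatibility clause `cgGraph_adj_flip_iff` (cross-conflict edges compare
  the represented values of a shared variable, both shifted by its flip: `bit_cgShift`).
* `cg_maxDegree_le` — maximum degree `≤ 3` when the occurrence labelling is injective on the occurrences of each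
  variable: slots (two connectors + fork or conflict partner), connectors (`2`), `a`-vertices (`2`), `b`-vertices
  (`a`-vertex + the two conflicting assignments of the unique occurrence with the given label).
[folklore]
-/

noncomputable section

open scoped Classical BigOperators

namespace Summit.PneNP.PneNP.Theorems.MacroscopicTwinsAbove.HighActivity

open Finset
open Summit.PneNP.PneNP.Cruxes.MacroscopicTwinsAbove.LiteralGadgetsCfiApparatus (lgScope)
open Literature.ModelTheory.FiniteModelTheory.CFIMatching (bit)

-- `Summit.PneNP.PneNP.…` (summit = sub-problem name) trips the duplicate-namespace linter on every declaration.
set_option linter.dupNamespace false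

variable {nv m D : ℕ}

/-! ## Duplicator -/

section Duplicator

open Literature.ModelTheory.FiniteModelTheory (CkEquiv IsConsistencyFamily IsLocalFlipAction
  ckEquiv_of_consistencyFamily)
open Literature.ModelTheory.FiniteModelTheory.XorSystem (Good good_empty good_extend)
open Summit.PneNP.PneNP.Cruxes.MacroscopicTwinsAbove.LiteralGadgetsCfiApparatus (bit_flip sum_lgScope_eq)

/-- Under a consistent assignment whose domain contains the scope of `e`, the represented bits of equation `e`
transform additively: `bit (c e) (S + shift) i = bit 0 S i + f (E e i)`. [folklore] -/
theorem bit_cgShift (E : Fin m → Fin 3 → Fin nv) (hE : ∀ e, Function.Injective (E e)) (c : Fin m → ZMod 2)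
    {s : ℕ} (hs : 1 ≤ s) {dom : Finset (Fin nv)} {f : Fin nv → ZMod 2} (hf : Good (lgScope E) c s dom f)
    {e : Fin m} (he : lgScope E e ⊆ dom) (S : Fin 2 → ZMod 2) (i : Fin 3) :
    bit (c e) (S + cgShift E f e) i = bit 0 S i + f (E e i) := by
  have hsum : f (E e 0) + f (E e 1) + f (E e 2) = c e := by
    rw [← sum_lgScope_eq E hE f e]
    exact hf.sum_scope_eq hs he
  exact bit_flip (fun i => f (E e i)) hsum S i

/-- **The flip by a consistent assignment transports `cgRel … 0` to `cgRel … c`** between two vertices whose data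
(the scopes of their equations) lies in the domain: gadget-internal edges and same-equation conflicts compare pieces
and bits of ONE equation, all shifted by the same translation; a cross conflict compares the represented values of a
shared variable `x`, both shifted by `f x` (`bit_cgShift` for the two equations). [folklore] -/
theorem cgRel_flip_iff (E : Fin m → Fin 3 → Fin nv) (hE : ∀ e, Function.Injective (E e))
    (loc : Fin m × Fin 3 → Fin D) (c : Fin m → ZMod 2) {s : ℕ} (hs : 1 ≤ s)
    {dom : Finset (Fin nv)} {f : Fin nv → ZMod 2} (hf : Good (lgScope E) c s dom f) {x y : CGVert m D}
    (hx : cgData E x ⊆ dom) (hy : cgData E y ⊆ dom) :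
    cgRel E loc c (cgFlipFun E f x) (cgFlipFun E f y) ↔ cgRel E loc 0 x y := by
  obtain ⟨e, S, p⟩ := x
  obtain ⟨e', S', p'⟩ := y
  have hx' : lgScope E e ⊆ dom := hx
  have hy' : lgScope E e' ⊆ dom := hy
  rcases p with σ | j | π | π <;> rcases p' with σ' | j' | π' | π' <;>
    simp only [cgFlipFun_apply, cgRel, Pi.zero_apply]
  · -- slot / slot : same-equation conflict
    constructor
    · rintro ⟨rfl, hσ, h0, hS⟩
      refine ⟨rfl, hσ, h0, ?_⟩
      rw [add_right_comm] at hS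
      exact add_right_cancel hS
    · rintro ⟨rfl, hσ, h0, rfl⟩
      exact ⟨rfl, hσ, h0, add_right_comm _ _ _⟩
  · -- slot / fork a
    constructor
    · rintro ⟨rfl, hS, h⟩
      exact ⟨rfl, add_right_cancel hS, h⟩
    · rintro ⟨rfl, rfl, h⟩
      exact ⟨rfl, rfl, h⟩
  · -- connector / slot
    constructor
    · rintro ⟨rfl, hS, h⟩
      exact ⟨rfl, add_right_cancel hS, h⟩
    · rintro ⟨rfl, rfl, h⟩
      exact ⟨rfl, rfl, h⟩
  · -- fork a / fork b
    constructor
    · rintro ⟨rfl, hS, h⟩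
      exact ⟨rfl, add_right_cancel hS, h⟩
    · rintro ⟨rfl, rfl, h⟩
      exact ⟨rfl, rfl, h⟩
  · -- fork b / fork b : cross conflict
    rw [bit_cgShift E hE c hs hf hx' S π.1, bit_cgShift E hE c hs hf hy' S' π'.1]
    constructor
    · rintro ⟨hEq, h1, h2, hne⟩
      refine ⟨hEq, h1, h2, fun h => hne ?_⟩
      rw [h, hEq]
    · rintro ⟨hEq, h1, h2, hne⟩
      refine ⟨hEq, h1, h2, fun h => hne ?_⟩
      rw [hEq] at h
      exact add_right_cancel h

/-- **Compatibility** (the hypothesis `hcompat` of `ckEquiv_of_consistencyFamily`): the flip by a consistent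
assignment preserves and reflects adjacency `cgGraph … 0 → cgGraph … c` between any two vertices whose data lies
in the domain. [folklore] -/
theorem cgGraph_adj_flip_iff (E : Fin m → Fin 3 → Fin nv) (hE : ∀ e, Function.Injective (E e))
    (loc : Fin m × Fin 3 → Fin D) (c : Fin m → ZMod 2) {s : ℕ} (hs : 1 ≤ s)
    {dom : Finset (Fin nv)} {f : Fin nv → ZMod 2} (hf : Good (lgScope E) c s dom f) {x y : CGVert m D}
    (hx : cgData E x ⊆ dom) (hy : cgData E y ⊆ dom) :
    (cgGraph E loc c).Adj (cgFlip E f x) (cgFlip E f y) ↔ (cgGraph E loc 0).Adj x y := by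
  have hinv : Function.Involutive (cgFlipFun (D := D) E f) := cgFlipFun_cgFlipFun E f
  rw [cgFlip_apply, cgFlip_apply, cgGraph_adj, cgGraph_adj, hinv.injective.ne_iff,
    cgRel_flip_iff E hE loc c hs hf hx hy, cgRel_flip_iff E hE loc c hs hf hy hx]

/-- **Duplicator** (Atserias–Dawar 2019 Lemma 3.2 in the abstract form `ckEquiv_of_consistencyFamily`): on an
`(s, q/p)`-boundary expander with three distinct variables per equation, `2pK₀ ≤ qs` and `3k ≤ K₀`, the
conflict-gadget graphs of ANY right-hand side `c` and of `0` are `≡_{C^k}` — for every occurrence labelling.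
[folklore] -/
theorem cg_ckEquiv (E : Fin m → Fin 3 → Fin nv) (hE : ∀ e, Function.Injective (E e))
    (loc : Fin m × Fin 3 → Fin D) (c : Fin m → ZMod 2) {s p q K₀ k : ℕ} (hs : 1 ≤ s) (hq : 0 < q)
    (hexp : ∀ T : Finset (Fin m), T.card ≤ s →
      q * T.card ≤ p * (Literature.ModelTheory.FiniteModelTheory.XorSystem.boundary (lgScope E) T).card)
    (hK₀ : 2 * p * K₀ ≤ q * s) (hk : 3 * k ≤ K₀) :
    CkEquiv k (cgGraph E loc (0 : Fin m → ZMod 2) : SimpleGraph (CGVert m D)) (cgGraph E loc c) := by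
  have hG : IsConsistencyFamily (Good (lgScope E) c s) K₀ :=
    ⟨good_empty hq hexp, fun _ _ _ h hsub => h.mono hsub, fun _ _ _ h hfg => h.congr hfg,
      fun _ _ h hcard x => good_extend hq hexp hK₀ h hcard x⟩
  exact ckEquiv_of_consistencyFamily (R := ZMod 2) hG (isLocalFlipAction_cgFlip E) (card_cgData_le E)
    (fun _ _ _ _ hf hx hy => cgGraph_adj_flip_iff E hE loc c hs hf hx hy) hk

end Duplicator

/-! ## Maximum degree three -/

section MaxDegree

open Summit.PneNP.PneNP.Cruxes.PolyDepthTwinsAbove.ParityWiredPorts (card_filter_bit_le)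

variable (E : Fin m → Fin 3 → Fin nv) (loc : Fin m × Fin 3 → Fin D) (c : Fin m → ZMod 2)

/-- At most two connectors touch a given slot (the one before and the one after it). [folklore] -/
theorem card_connectors_le (σ : Fin (3 * D + 2 + 1)) :
    ((univ : Finset (Fin (3 * D + 2))).filter fun j => σ = j.castSucc ∨ σ = j.succ).card ≤ 2 := by
  have h1 : ((univ : Finset (Fin (3 * D + 2))).filter fun j => σ = j.castSucc).card ≤ 1 :=
    card_le_one.2 fun a ha b hb => Fin.castSucc_injective _
      ((mem_filter.1 ha).2.symm.trans (mem_filter.1 hb).2)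
  have h2 : ((univ : Finset (Fin (3 * D + 2))).filter fun j => σ = j.succ).card ≤ 1 :=
    card_le_one.2 fun a ha b hb => Fin.succ_injective _
      ((mem_filter.1 ha).2.symm.trans (mem_filter.1 hb).2)
  rw [filter_or]
  exact (card_union_le _ _).trans (by omega)

/-- In `ZMod 2`, differing from `β` means being `β + 1`. [folklore] -/
theorem zmod2_ne_iff (a β : ZMod 2) : a ≠ β ↔ a = β + 1 := by
  revert a β; decide

/-- **Slots have degree `≤ 3`**: two connectors, and either the fork vertex `a` (cross slots) or the
same-equation conflict partner (direction slots). [folklore] -/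
theorem degree_slot_le (e : Fin m) (S : Fin 2 → ZMod 2) (σ : Fin (3 * D + 2 + 1)) :
    (cgGraph E loc c).degree (vS e S σ) ≤ 3 := by
  set Cset : Finset (CGVert m D) :=
    ((univ : Finset (Fin (3 * D + 2))).filter fun j => σ = j.castSucc ∨ σ = j.succ).image (vC e S)
  set Aset : Finset (CGVert m D) :=
    ((univ : Finset (Fin 3 × Fin D)).filter fun π => slotKind D σ = (π.1, π.2.succ)).image (vA e S)
  set Pset : Finset (CGVert m D) :=
    if (slotKind D σ).2 = 0 then {vS e (S + dvec (slotKind D σ).1) σ} else ∅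
  have hsub : (cgGraph E loc c).neighborFinset (vS e S σ) ⊆ Cset ∪ (Aset ∪ Pset) := by
    intro z hz
    rw [SimpleGraph.mem_neighborFinset, cgGraph_adj] at hz
    obtain ⟨-, hz⟩ := hz
    obtain ⟨e', S', p'⟩ := z
    rcases p' with σ' | j' | π' | π' <;> simp only [vS, cgRel, or_false, false_or] at hz
    · -- slot: the conflict partner, in either direction
      refine mem_union_right _ (mem_union_right _ ?_)
      rcases hz with ⟨rfl, rfl, h0, rfl⟩ | ⟨rfl, rfl, h0, hS⟩
      · simp only [Pset, h0, ↓reduceIte, mem_singleton, vS]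
      · simp only [Pset, h0, ↓reduceIte, mem_singleton, vS]
        rw [hS, add_dvec_add_dvec]
    · -- connector
      obtain ⟨rfl, rfl, hj⟩ := hz
      exact mem_union_left _ (mem_image.2 ⟨j', mem_filter.2 ⟨mem_univ _, hj⟩, rfl⟩)
    · -- fork a
      obtain ⟨rfl, rfl, hπ⟩ := hz
      exact mem_union_right _ (mem_union_left _ (mem_image.2 ⟨π', mem_filter.2 ⟨mem_univ _, hπ⟩, rfl⟩))
  have hC : Cset.card ≤ 2 := card_image_le.trans (card_connectors_le σ)
  have hA : Aset.card ≤ (if (slotKind D σ).2 = 0 then 0 else 1) := by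
    split_ifs with h0
    · rw [Nat.le_zero, card_eq_zero, image_eq_empty, filter_eq_empty_iff]
      intro π _ hπ
      have := congr_arg Prod.snd hπ
      rw [h0] at this
      exact Fin.succ_ne_zero _ this.symm
    · refine card_image_le.trans (card_le_one.2 fun a ha b hb => ?_)
      have ha' := (mem_filter.1 ha).2
      have hb' := (mem_filter.1 hb).2
      have h := ha'.symm.trans hb'
      simp only [Prod.mk.injEq] at h
      exact Prod.ext h.1 (Fin.succ_injective _ h.2)
  have hP : Pset.card ≤ (if (slotKind D σ).2 = 0 then 1 else 0) := by
    simp only [Pset]; split_ifs <;> simp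
  calc (cgGraph E loc c).degree (vS e S σ)
      = ((cgGraph E loc c).neighborFinset (vS e S σ)).card := (SimpleGraph.card_neighborFinset_eq_degree _ _).symm
    _ ≤ (Cset ∪ (Aset ∪ Pset)).card := card_le_card hsub
    _ ≤ Cset.card + (Aset.card + Pset.card) :=
        (card_union_le _ _).trans (Nat.add_le_add_left (card_union_le _ _) _)
    _ ≤ 3 := by split_ifs at hA hP <;> omega

/-- **Connectors have degree `≤ 2`**: the two slots they join. [folklore] -/
theorem degree_conn_le (e : Fin m) (S : Fin 2 → ZMod 2) (j : Fin (3 * D + 2)) :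
    (cgGraph E loc c).degree (vC e S j) ≤ 2 := by
  have hsub : (cgGraph E loc c).neighborFinset (vC e S j) ⊆ {vS e S j.castSucc, vS e S j.succ} := by
    intro z hz
    rw [SimpleGraph.mem_neighborFinset, cgGraph_adj] at hz
    obtain ⟨-, hz⟩ := hz
    obtain ⟨e', S', p'⟩ := z
    rcases p' with σ' | j' | π' | π' <;> simp only [vC, cgRel, or_false] at hz
    obtain ⟨rfl, rfl, rfl | rfl⟩ := hz
    · exact mem_insert_self _ _
    · exact mem_insert_of_mem (mem_singleton_self _)
  calc (cgGraph E loc c).degree (vC e S j)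
      = ((cgGraph E loc c).neighborFinset (vC e S j)).card := (SimpleGraph.card_neighborFinset_eq_degree _ _).symm
    _ ≤ ({vS e S j.castSucc, vS e S j.succ} : Finset (CGVert m D)).card := card_le_card hsub
    _ ≤ 2 := card_insert_le _ _ |>.trans (by simp)

/-- **`a`-vertices have degree `≤ 2`**: their slot and their `b`-vertex. [folklore] -/
theorem degree_forkA_le (e : Fin m) (S : Fin 2 → ZMod 2) (π : Fin 3 × Fin D) :
    (cgGraph E loc c).degree (vA e S π) ≤ 2 := by
  have hsub : (cgGraph E loc c).neighborFinset (vA e S π) ⊆ {vS e S (forkSlot D π), vB e S π} := by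
    intro z hz
    rw [SimpleGraph.mem_neighborFinset, cgGraph_adj] at hz
    obtain ⟨-, hz⟩ := hz
    obtain ⟨e', S', p'⟩ := z
    rcases p' with σ' | j' | π' | π' <;> simp only [vA, cgRel, or_false, false_or] at hz
    · obtain ⟨rfl, rfl, hσ⟩ := hz
      have hσ' : σ' = forkSlot D π := by
        rw [forkSlot, ← hσ, Equiv.symm_apply_apply]
      rw [hσ']
      exact mem_insert_self _ _
    · obtain ⟨rfl, rfl, rfl⟩ := hz
      exact mem_insert_of_mem (mem_singleton_self _)
  calc (cgGraph E loc c).degree (vA e S π)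
      = ((cgGraph E loc c).neighborFinset (vA e S π)).card := (SimpleGraph.card_neighborFinset_eq_degree _ _).symm
    _ ≤ ({vS e S (forkSlot D π), vB e S π} : Finset (CGVert m D)).card := card_le_card hsub
    _ ≤ 2 := card_insert_le _ _ |>.trans (by simp)

/-- **`b`-vertices have degree `≤ 3`** when `loc` is injective on the occurrences of each variable: the
`a`-vertex, and the two conflicting assignments of the unique occurrence with the given label. [folklore] -/
theorem degree_forkB_le (hloc : ∀ p p' : Fin m × Fin 3, E p.1 p.2 = E p'.1 p'.2 → loc p = loc p' → p = p')
    (e : Fin m) (S : Fin 2 → ZMod 2) (π : Fin 3 × Fin D) :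
    (cgGraph E loc c).degree (vB e S π) ≤ 3 := by
  set Occ : Finset (Fin m × Fin 3) := univ.filter fun q => E q.1 q.2 = E e π.1 ∧ loc q = π.2
  set Bset : Finset (CGVert m D) := Occ.biUnion fun q =>
    ((univ : Finset (Fin 2 → ZMod 2)).filter fun S' => bit (c q.1) S' q.2 = bit (c e) S π.1 + 1).image
      fun S' => vB q.1 S' (q.2, loc (e, π.1))
  have hsub : (cgGraph E loc c).neighborFinset (vB e S π) ⊆ insert (vA e S π) Bset := by
    intro z hz
    rw [SimpleGraph.mem_neighborFinset, cgGraph_adj] at hz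
    obtain ⟨-, hz⟩ := hz
    obtain ⟨e', S', p'⟩ := z
    rcases p' with σ' | j' | π' | π' <;> simp only [vB, cgRel, or_false, false_or] at hz
    · obtain ⟨rfl, rfl, rfl⟩ := hz
      exact mem_insert_self _ _
    · refine mem_insert_of_mem (mem_biUnion.2 ?_)
      have key : E e' π'.1 = E e π.1 ∧ loc (e', π'.1) = π.2 ∧ loc (e, π.1) = π'.2 ∧
          bit (c e') S' π'.1 = bit (c e) S π.1 + 1 := by
        rcases hz with ⟨h1, h2, h3, h4⟩ | ⟨h1, h2, h3, h4⟩
        · exact ⟨h1, h2, h3, (zmod2_ne_iff _ _).1 (Ne.symm h4)⟩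
        · exact ⟨h1.symm, h3, h2, (zmod2_ne_iff _ _).1 h4⟩
      obtain ⟨h1, h2, h3, h4⟩ := key
      refine ⟨(e', π'.1), mem_filter.2 ⟨mem_univ _, h1, h2⟩, mem_image.2 ⟨S', mem_filter.2 ⟨mem_univ _, h4⟩, ?_⟩⟩
      simp only [vB, h3]
  have hOcc : Occ.card ≤ 1 := card_le_one.2 fun q hq q' hq' => by
    have hq1 := (mem_filter.1 hq).2
    have hq2 := (mem_filter.1 hq').2
    exact hloc q q' (hq1.1.trans hq2.1.symm) (hq1.2.trans hq2.2.symm)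
  have hB : Bset.card ≤ 2 := by
    refine card_biUnion_le.trans ?_
    calc ∑ q ∈ Occ, (((univ : Finset (Fin 2 → ZMod 2)).filter fun S' =>
            bit (c q.1) S' q.2 = bit (c e) S π.1 + 1).image fun S' => vB q.1 S' (q.2, loc (e, π.1))).card
        ≤ ∑ _q ∈ Occ, 2 := sum_le_sum fun q _ => card_image_le.trans (card_filter_bit_le _ _ _)
      _ = Occ.card * 2 := by rw [sum_const, smul_eq_mul]
      _ ≤ 2 := by omega
  calc (cgGraph E loc c).degree (vB e S π)
      = ((cgGraph E loc c).neighborFinset (vB e S π)).card := (SimpleGraph.card_neighborFinset_eq_degree _ _).symm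
    _ ≤ (insert (vA e S π) Bset).card := card_le_card hsub
    _ ≤ Bset.card + 1 := card_insert_le _ _
    _ ≤ 3 := by omega

/-- **The conflict-gadget graph has maximum degree `≤ 3`** (for every right-hand side), provided `loc` is
injective on the occurrences of each variable. [folklore] -/
theorem cg_maxDegree_le (hloc : ∀ p p' : Fin m × Fin 3, E p.1 p.2 = E p'.1 p'.2 → loc p = loc p' → p = p') :
    (cgGraph E loc c).maxDegree ≤ 3 := by
  refine SimpleGraph.maxDegree_le_of_forall_degree_le _ _ fun z => ?_
  obtain ⟨e, S, p⟩ := z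
  rcases p with σ | j | π | π
  · exact degree_slot_le E loc c e S σ
  · exact (degree_conn_le E loc c e S j).trans (by norm_num)
  · exact (degree_forkA_le E loc c e S π).trans (by norm_num)
  · exact degree_forkB_le E loc c hloc e S π

end MaxDegree

end Summit.PneNP.PneNP.Theorems.MacroscopicTwinsAbove.HighActivity
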